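import Literature.MathematicalPhysics.QuantumFieldTheory.Balaban1983to89.Beta.CrossTermBounds

/-!
# `BalabanUV.Beta.FP.PerfectContact` — road «FP» for binder row D1, leaf N7d-T: CONTACT / TADPOLE TERMS CONTRIBUTE `O(1)` TO β —
# a LOCAL fine kernel `T` (supported in the sup-ball of radius `ρ`, entries `≤ B`) has moments `‖M0 T‖ ≤ (2ρ+1)⁴B`,
# `‖M1 T‖ ≤ (2ρ+1)⁴ρB`, `‖M2 T‖ ≤ (2ρ+1)⁴ρ²B`, and its DRESSED (1.22)-moment `M2(h ⋆ T ⋆ h′)` is bounded by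
# `(2ρ+1)⁴·B·(2J₂J₀ + ρ²J₀² + 4ρJ₁J₀ + 2J₁²)` in the moment letters of the dressing kernels — no Ward hypothesis, no `log`

HONEST FRAMING (cell contract, verbatim): «discharging `BetaPertH` makes Bałaban's UV stability UNCONDITIONAL — a real constructive-QFT
result; it is NOT the continuum limit and NOT the Clay problem.»  HONEST DEPENDENCY (verbatim): «continuum YM on T⁴ ⇐ BetaPertH ∧ nine
spine estimates (0/9 proved); BetaPertH ⇐ (D1) ∧ (D4) ∧ CAP+tail; G-an2-4 gates asym, D1 and NE2/3/4.»  This module is [folklore]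
bookkeeping in a normed ring, composed BY NAME from the tree (`MomentFactorisation.M0/M1/M2/conv/M2_dressed_nine/tsum_eq_M2`,
`CrossTermBounds.norm_moment_le/moment_eq_sum_box/abs_cast_apply_le_supNorm/mul_three_le`, `ThermodynamicLimit.card_box`,
`DyadicShell.supNorm/mem_box_iff`, Mathlib `norm_mul₃_le`).  It cites nothing, defines nothing, mints no `Prop`, and asserts NOTHING
about Bałaban's operators or about the perfect objects of road FP: `T`, `h`, `h′` are ARBITRARY finitely supported lattice functions.
It discharges nothing of the wall; NOT summit progress; NOT BetaPertH, NOT continuum, NOT Clay.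

WHY (skeleton `HOME/beta/skeletons/D1-b2b-balaban-beta-d1-p3.md` v1.3 §3 N7d «(T) tadpole/contact terms contribute O(1) to β (local
kernels: zero μ ≠ ν second-moment germ; `CrossTermBounds`, `MomentFactorisation`)», claim table `HOME/b2b-balaban-beta-d1-p3/LEAVES-FP.md`
row N7d-T; the companion BF-x leaf A6 is `D1BFx/ContactCount`, which treats the same terms in the `ExpKernelCalculus`/`fullSum` frame).
In the log-det route the one-loop coefficient `β` is the `x_μx_ν`-moment ([Balaban1987RG1] (1.22) p. 264 — CONTEXT ONLY, nothing printed
is used) of a DRESSED kernel `h ⋆ T ⋆ h′` (`T` the fine-level Hessian of the step, `h`, `h′` the linear responses of the minimiser;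
`MomentFactorisation` header), and `MomentFactorisation.M2_dressed_nine` expands that moment EXACTLY into nine products of moments of
the three factors.  The MAIN term of the fold needs the Ward-type hypotheses and carries the `log` (its `T` is the massless bubble,
`CrossTermBounds.norm_M2_le_of_decay` is only harmonic).  The CONTACT / TADPOLE table is the opposite case: `T` is LOCAL — finitely
many offsets `‖x‖∞ ≤ ρ` with bounded coefficients (`BubbleTable.contact_stencil`: values of the propagator at BOUNDED offsets times vertex
traces; for the perfect one-shot of road FP the same with the perfect propagator) — so ALL its moments are finite sums, bounded by
`#ball × ρ^k × B` (§1), and the nine-term expansion bounds the dressed moment by products of these with the dressing letters (§2–§3),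
with NO Ward hypothesis (a contact kernel need not annihilate constants) and NO `log`.  That is the whole content of «contact terms are
O(1)»: the right-hand side below is free of every scale as soon as `(ρ, B)` and the letters `(J₀, J₁, J₂)` are.  WHAT STAYS OPEN (the
assembler's, after leaf N0b): that the perfect one-shot's contact table IS such a `T` with step-free `(ρ, B)`, and that the perfect
transport columns have step-free letters — hypotheses on free parameters here.

CONTENT (all [folklore]; `R` any normed ring, `d = 4` where the sup-norm ball is used).
* §1 `card_support_le_of_local` (`#supp T ≤ (2ρ+1)⁴`), `norm_moment_le_of_local` (`|φ| ≤ Φ` on the support ⇒ `‖moment φ T‖ ≤ (2ρ+1)⁴·Φ·B`),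
  **`norm_M0_le_of_local`**, **`norm_M1_le_of_local`**, **`norm_M2_le_of_local`**.
* §2 `norm_M2_dressed_le_nine` (the nine products in norm), **`norm_M2_dressed_le_letters`** (`≤ 2J₂T₀J₀ + J₀T₂J₀ + 4J₁T₁J₀ + 2J₁T₀J₁`).
* §3 **`norm_M2_dressed_le_of_local`** — LOCAL `T` ⇒ `‖M2 μν (h⋆T⋆h′)‖ ≤ (2ρ+1)⁴·B·(2J₂J₀ + ρ²J₀² + 4ρJ₁J₀ + 2J₁²)`; the undressed case is §1.
* §4 (`R = ℝ`) **`abs_tsum_dressed_le_of_local`** — the same for the printed shape `Σ' x, (h⋆T⋆h′)(x)·x_μ·x_ν` of the (1.22) moment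
  (`MomentFactorisation.tsum_eq_M2`), and `abs_tsum_le_of_local` for `T` itself.
-/

namespace Summit.QuantumFields.BalabanUV.Beta.FP.PerfectContact

open Finset
open Literature.Probability.LatticeModels (box card_box)
open Literature.MathematicalPhysics.QuantumFieldTheory.Balaban1983to89
open Literature.MathematicalPhysics.QuantumFieldTheory.Balaban1983to89.Beta
open MomentFactorisation (LatFun conv moment M0 M1 M2 M2_dressed_nine tsum_eq_M2)
open CrossTermBounds (norm_moment_le moment_eq_sum_box abs_cast_apply_le_supNorm mul_three_le)
open DyadicShell (Pt supNorm mem_box_iff)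

noncomputable section

/-! ## §1 Moments of a LOCAL kernel on `ℤ⁴` -/

section Local

variable {R : Type*} [NormedRing R]

/-- [folklore] A kernel supported in the sup-ball of radius `ρ` has at most `(2ρ+1)⁴` support points (`card_box`). -/
theorem card_support_le_of_local (T : LatFun 4 R) {ρ : ℕ} (hρ : ∀ x ∈ T.support, supNorm x ≤ ρ) :
    (T.support.card : ℝ) ≤ (2 * (ρ : ℝ) + 1) ^ 4 := by
  have hsub : T.support ⊆ box 4 ρ := fun x hx => mem_box_iff.mpr (hρ x hx)
  have h := Finset.card_le_card hsub
  rw [card_box] at h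
  calc (T.support.card : ℝ) ≤ (((2 * ρ + 1) ^ 4 : ℕ) : ℝ) := by exact_mod_cast h
    _ = (2 * (ρ : ℝ) + 1) ^ 4 := by push_cast; ring

/-- [folklore] **MOMENT OF A LOCAL KERNEL.**  If `T` is supported in the sup-ball of radius `ρ`, `‖T x‖ ≤ B` on the support, and the
integer weight satisfies `|φ x| ≤ Φ` on the support (`Φ ≥ 0`, `B ≥ 0`), then `‖moment φ T‖ ≤ (2ρ+1)⁴·Φ·B` — a finite sum of at most
`(2ρ+1)⁴` terms each `≤ Φ·B` (`CrossTermBounds.norm_moment_le`). -/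
theorem norm_moment_le_of_local (φ : Pt → ℤ) (T : LatFun 4 R) {ρ : ℕ} {Φ B : ℝ} (hΦ : 0 ≤ Φ) (hB : 0 ≤ B)
    (hρ : ∀ x ∈ T.support, supNorm x ≤ ρ) (hT : ∀ x ∈ T.support, ‖T x‖ ≤ B)
    (hφ : ∀ x ∈ T.support, (|(φ x : ℤ)| : ℝ) ≤ Φ) : ‖moment φ T‖ ≤ (2 * (ρ : ℝ) + 1) ^ 4 * (Φ * B) := by
  calc ‖moment φ T‖ ≤ ∑ x ∈ T.support, (|(φ x : ℤ)| : ℝ) * ‖T x‖ := norm_moment_le φ T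
    _ ≤ ∑ _x ∈ T.support, Φ * B :=
        Finset.sum_le_sum fun x hx => mul_le_mul (hφ x hx) (hT x hx) (norm_nonneg _) hΦ
    _ = (T.support.card : ℝ) * (Φ * B) := by rw [Finset.sum_const, nsmul_eq_mul]
    _ ≤ (2 * (ρ : ℝ) + 1) ^ 4 * (Φ * B) :=
        mul_le_mul_of_nonneg_right (card_support_le_of_local T hρ) (mul_nonneg hΦ hB)

/-- [folklore] On the sup-ball of radius `ρ`: `|x_μ| ≤ ρ` (as a real number, for the cast integer coordinate). -/
theorem abs_cast_apply_le_of_local {x : Pt} {ρ : ℕ} (hx : supNorm x ≤ ρ) (μ : Fin 4) : (|(x μ : ℤ)| : ℝ) ≤ (ρ : ℝ) :=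
  calc |((x μ : ℤ) : ℝ)| ≤ (supNorm x : ℝ) := abs_cast_apply_le_supNorm x μ
    _ ≤ (ρ : ℝ) := by exact_mod_cast hx

/-- [folklore] **`‖M0 T‖ ≤ (2ρ+1)⁴·B`** for a local kernel. -/
theorem norm_M0_le_of_local (T : LatFun 4 R) {ρ : ℕ} {B : ℝ} (hB : 0 ≤ B) (hρ : ∀ x ∈ T.support, supNorm x ≤ ρ)
    (hT : ∀ x ∈ T.support, ‖T x‖ ≤ B) : ‖M0 T‖ ≤ (2 * (ρ : ℝ) + 1) ^ 4 * B := by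
  have h := norm_moment_le_of_local (fun _ => (1 : ℤ)) T zero_le_one hB hρ hT (fun x _ => by simp)
  rw [one_mul] at h
  exact h

/-- [folklore] **`‖M1_μ T‖ ≤ (2ρ+1)⁴·ρ·B`** for a local kernel (`|x_μ| ≤ ρ` on the support). -/
theorem norm_M1_le_of_local (μ : Fin 4) (T : LatFun 4 R) {ρ : ℕ} {B : ℝ} (hB : 0 ≤ B) (hρ : ∀ x ∈ T.support, supNorm x ≤ ρ)
    (hT : ∀ x ∈ T.support, ‖T x‖ ≤ B) : ‖M1 μ T‖ ≤ (2 * (ρ : ℝ) + 1) ^ 4 * ((ρ : ℝ) * B) :=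
  norm_moment_le_of_local (fun x => x μ) T (Nat.cast_nonneg ρ) hB hρ hT (fun x hx => abs_cast_apply_le_of_local (hρ x hx) μ)

/-- [folklore] **`‖M2_{μν} T‖ ≤ (2ρ+1)⁴·ρ²·B`** for a local kernel (`|x_μ x_ν| ≤ ρ²` on the support) — a FINITE number, no `log`:
the undressed form of «the contact term's (1.22)-moment is `O(1)`». -/
theorem norm_M2_le_of_local (μ ν : Fin 4) (T : LatFun 4 R) {ρ : ℕ} {B : ℝ} (hB : 0 ≤ B) (hρ : ∀ x ∈ T.support, supNorm x ≤ ρ)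
    (hT : ∀ x ∈ T.support, ‖T x‖ ≤ B) : ‖M2 μ ν T‖ ≤ (2 * (ρ : ℝ) + 1) ^ 4 * ((ρ : ℝ) ^ 2 * B) := by
  refine norm_moment_le_of_local (fun x => x μ * x ν) T (by positivity) hB hρ hT (fun x hx => ?_)
  have hμ := abs_cast_apply_le_of_local (hρ x hx) μ
  have hν := abs_cast_apply_le_of_local (hρ x hx) ν
  rw [Int.cast_mul, abs_mul, sq]
  exact mul_le_mul hμ hν (abs_nonneg _) (Nat.cast_nonneg ρ)

end Local

/-! ## §2 The nine-term dressing in norm (no Ward hypothesis) -/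

section Nine

variable {d : ℕ} {R : Type*} [NormedRing R]

/-- [folklore] **THE DRESSED SECOND MOMENT IN NORM, ALL NINE TERMS** (`MomentFactorisation.M2_dressed_nine` + triangle inequality +
`norm_mul₃_le`): no hypothesis on `T` — the form a CONTACT kernel needs (it does not annihilate constants, so the Ward-type reduction
`M2_dressed_ward` to «main + six» is not available, and not needed). -/
theorem norm_M2_dressed_le_nine (μ ν : Fin d) (h T h' : LatFun d R) :
    ‖M2 μ ν (conv (conv h T) h')‖ ≤
      ‖M2 μ ν h‖ * ‖M0 T‖ * ‖M0 h'‖ + ‖M0 h‖ * ‖M2 μ ν T‖ * ‖M0 h'‖ + ‖M0 h‖ * ‖M0 T‖ * ‖M2 μ ν h'‖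
      + ‖M1 μ h‖ * ‖M1 ν T‖ * ‖M0 h'‖ + ‖M1 ν h‖ * ‖M1 μ T‖ * ‖M0 h'‖
      + ‖M0 h‖ * ‖M1 μ T‖ * ‖M1 ν h'‖ + ‖M0 h‖ * ‖M1 ν T‖ * ‖M1 μ h'‖
      + ‖M1 μ h‖ * ‖M0 T‖ * ‖M1 ν h'‖ + ‖M1 ν h‖ * ‖M0 T‖ * ‖M1 μ h'‖ := by
  rw [M2_dressed_nine]
  refine (norm_add_le _ _).trans (add_le_add ?_ norm_mul₃_le)
  refine (norm_add_le _ _).trans (add_le_add ?_ norm_mul₃_le)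
  refine (norm_add_le _ _).trans (add_le_add ?_ norm_mul₃_le)
  refine (norm_add_le _ _).trans (add_le_add ?_ norm_mul₃_le)
  refine (norm_add_le _ _).trans (add_le_add ?_ norm_mul₃_le)
  refine (norm_add_le _ _).trans (add_le_add ?_ norm_mul₃_le)
  refine (norm_add_le _ _).trans (add_le_add ?_ norm_mul₃_le)
  exact (norm_add_le _ _).trans (add_le_add norm_mul₃_le norm_mul₃_le)

/-- [folklore] **WITH UNIFORM LETTERS**: `‖M0 h‖, ‖M0 h′‖ ≤ J₀`, `‖M1_• h‖, ‖M1_• h′‖ ≤ J₁`, `‖M2_{μν} h‖, ‖M2_{μν} h′‖ ≤ J₂` for the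
dressing kernels and `‖M0 T‖ ≤ T₀`, `‖M1_• T‖ ≤ T₁`, `‖M2_{μν} T‖ ≤ T₂` for the dressed one ⟹
`‖M2_{μν}(h⋆T⋆h′)‖ ≤ 2·J₂T₀J₀ + J₀T₂J₀ + 4·J₁T₁J₀ + 2·J₁T₀J₁`. -/
theorem norm_M2_dressed_le_letters (μ ν : Fin d) (h T h' : LatFun d R) {J₀ J₁ J₂ T₀ T₁ T₂ : ℝ}
    (h0 : ‖M0 h‖ ≤ J₀) (h0' : ‖M0 h'‖ ≤ J₀) (h1μ : ‖M1 μ h‖ ≤ J₁) (h1ν : ‖M1 ν h‖ ≤ J₁) (h1μ' : ‖M1 μ h'‖ ≤ J₁)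
    (h1ν' : ‖M1 ν h'‖ ≤ J₁) (h2 : ‖M2 μ ν h‖ ≤ J₂) (h2' : ‖M2 μ ν h'‖ ≤ J₂) (t0 : ‖M0 T‖ ≤ T₀) (t1μ : ‖M1 μ T‖ ≤ T₁)
    (t1ν : ‖M1 ν T‖ ≤ T₁) (t2 : ‖M2 μ ν T‖ ≤ T₂) :
    ‖M2 μ ν (conv (conv h T) h')‖ ≤ 2 * (J₂ * T₀ * J₀) + J₀ * T₂ * J₀ + 4 * (J₁ * T₁ * J₀) + 2 * (J₁ * T₀ * J₁) := by
  have hnine := norm_M2_dressed_le_nine μ ν h T h'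
  have n := fun (a : R) => norm_nonneg a
  have e1 := mul_three_le (n _) (n _) (n _) h2 t0 h0'
  have e2 := mul_three_le (n _) (n _) (n _) h0 t2 h0'
  have e3 : ‖M0 h‖ * ‖M0 T‖ * ‖M2 μ ν h'‖ ≤ J₂ * T₀ * J₀ := by
    have := mul_three_le (n _) (n _) (n _) h0 t0 h2'; nlinarith [this]
  have e4 := mul_three_le (n _) (n _) (n _) h1μ t1ν h0'
  have e5 := mul_three_le (n _) (n _) (n _) h1ν t1μ h0'
  have e6 : ‖M0 h‖ * ‖M1 μ T‖ * ‖M1 ν h'‖ ≤ J₁ * T₁ * J₀ := by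
    have := mul_three_le (n _) (n _) (n _) h0 t1μ h1ν'; nlinarith [this]
  have e7 : ‖M0 h‖ * ‖M1 ν T‖ * ‖M1 μ h'‖ ≤ J₁ * T₁ * J₀ := by
    have := mul_three_le (n _) (n _) (n _) h0 t1ν h1μ'; nlinarith [this]
  have e8 := mul_three_le (n _) (n _) (n _) h1μ t0 h1ν'
  have e9 := mul_three_le (n _) (n _) (n _) h1ν t0 h1μ'
  linarith

end Nine

/-! ## §3 LOCAL `T` ⇒ the dressed (1.22)-moment is `O(1)` -/

section Dressed

variable {R : Type*} [NormedRing R]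

/-- [folklore] **LEAF N7d-T: A LOCAL (CONTACT / TADPOLE) KERNEL CONTRIBUTES `O(1)` TO THE DRESSED (1.22)-MOMENT.**  If `T` is supported in
the sup-ball of radius `ρ` of `ℤ⁴` with `‖T x‖ ≤ B` (`B ≥ 0`), and the dressing kernels `h`, `h′` have moment letters `J₀, J₁, J₂`
(`‖M0 ·‖ ≤ J₀`, `‖M1_μ ·‖, ‖M1_ν ·‖ ≤ J₁`, `‖M2_{μν} ·‖ ≤ J₂`; no sign hypotheses needed), then
`‖M2_{μν}(h ⋆ T ⋆ h′)‖ ≤ (2ρ+1)⁴·B·(2·J₂·J₀ + ρ²·J₀² + 4·ρ·J₁·J₀ + 2·J₁²)`.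
Every quantity on the right is scale-free when `(ρ, B, J₀, J₁, J₂)` are — no Ward hypothesis, no harmonic sum, no `log`.  Nothing about
Bałaban's or road FP's perfect objects is asserted: `T`, `h`, `h′` are arbitrary. -/
theorem norm_M2_dressed_le_of_local (μ ν : Fin 4) (h T h' : LatFun 4 R) {ρ : ℕ} {B J₀ J₁ J₂ : ℝ} (hB : 0 ≤ B)
    (hρ : ∀ x ∈ T.support, supNorm x ≤ ρ) (hT : ∀ x ∈ T.support, ‖T x‖ ≤ B)
    (h0 : ‖M0 h‖ ≤ J₀) (h0' : ‖M0 h'‖ ≤ J₀) (h1μ : ‖M1 μ h‖ ≤ J₁) (h1ν : ‖M1 ν h‖ ≤ J₁) (h1μ' : ‖M1 μ h'‖ ≤ J₁)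
    (h1ν' : ‖M1 ν h'‖ ≤ J₁) (h2 : ‖M2 μ ν h‖ ≤ J₂) (h2' : ‖M2 μ ν h'‖ ≤ J₂) :
    ‖M2 μ ν (conv (conv h T) h')‖ ≤
      (2 * (ρ : ℝ) + 1) ^ 4 * B * (2 * (J₂ * J₀) + (ρ : ℝ) ^ 2 * J₀ ^ 2 + 4 * ((ρ : ℝ) * J₁ * J₀) + 2 * J₁ ^ 2) := by
  have t0 := norm_M0_le_of_local T hB hρ hT
  have t1μ := norm_M1_le_of_local μ T hB hρ hT
  have t1ν := norm_M1_le_of_local ν T hB hρ hT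
  have t2 := norm_M2_le_of_local μ ν T hB hρ hT
  have hmain := norm_M2_dressed_le_letters μ ν h T h' h0 h0' h1μ h1ν h1μ' h1ν' h2 h2' t0 t1μ t1ν t2
  refine hmain.trans (le_of_eq ?_)
  ring

/-- [folklore] The same with the dressing letters collected crudely: if all six dressing letters are `≤ J` then
`‖M2_{μν}(h ⋆ T ⋆ h′)‖ ≤ (2ρ+1)⁴·B·J²·(4 + 4ρ + ρ²)` — one constant for the assembler. -/
theorem norm_M2_dressed_le_of_local' (μ ν : Fin 4) (h T h' : LatFun 4 R) {ρ : ℕ} {B J : ℝ} (hB : 0 ≤ B)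
    (hρ : ∀ x ∈ T.support, supNorm x ≤ ρ) (hT : ∀ x ∈ T.support, ‖T x‖ ≤ B)
    (h0 : ‖M0 h‖ ≤ J) (h0' : ‖M0 h'‖ ≤ J) (h1μ : ‖M1 μ h‖ ≤ J) (h1ν : ‖M1 ν h‖ ≤ J) (h1μ' : ‖M1 μ h'‖ ≤ J)
    (h1ν' : ‖M1 ν h'‖ ≤ J) (h2 : ‖M2 μ ν h‖ ≤ J) (h2' : ‖M2 μ ν h'‖ ≤ J) :
    ‖M2 μ ν (conv (conv h T) h')‖ ≤ (2 * (ρ : ℝ) + 1) ^ 4 * B * (J ^ 2 * (4 + 4 * (ρ : ℝ) + (ρ : ℝ) ^ 2)) := by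
  have hm := norm_M2_dressed_le_of_local μ ν h T h' hB hρ hT h0 h0' h1μ h1ν h1μ' h1ν' h2 h2'
  refine hm.trans (le_of_eq ?_)
  ring

end Dressed

/-! ## §4 `R = ℝ`: the printed (1.22) shape `Σ' x, f(x)·x_μ·x_ν` -/

section RealValued

/-- [folklore] **THE (1.22)-SUM OF A LOCAL KERNEL IS A BOUNDED FINITE SUM**: for a real finitely supported `T` in the sup-ball of radius
`ρ` with `|T x| ≤ B`, `|Σ' x, T(x)·x_μ·x_ν| ≤ (2ρ+1)⁴·ρ²·B` (`MomentFactorisation.tsum_eq_M2` + §1). -/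
theorem abs_tsum_le_of_local (μ ν : Fin 4) (T : LatFun 4 ℝ) {ρ : ℕ} {B : ℝ} (hB : 0 ≤ B)
    (hρ : ∀ x ∈ T.support, supNorm x ≤ ρ) (hT : ∀ x ∈ T.support, |T x| ≤ B) :
    |∑' x : Pt, T x * (x μ : ℝ) * (x ν : ℝ)| ≤ (2 * (ρ : ℝ) + 1) ^ 4 * ((ρ : ℝ) ^ 2 * B) := by
  rw [tsum_eq_M2, ← Real.norm_eq_abs]
  exact norm_M2_le_of_local μ ν T hB hρ (fun x hx => by rw [Real.norm_eq_abs]; exact hT x hx)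

/-- [folklore] **LEAF N7d-T IN THE PRINTED SHAPE**: for real kernels, the (1.22)-sum `Σ' x, (h⋆T⋆h′)(x)·x_μ·x_ν` of the dressed
CONTACT kernel is bounded by `(2ρ+1)⁴·B·(2J₂J₀ + ρ²J₀² + 4ρJ₁J₀ + 2J₁²)` — the contact/tadpole table contributes `O(1)` to `β`
whenever its support radius, its coefficient bound and the dressing letters are step-free.  (The identification of road FP's perfect
contact table and perfect transport columns with such `T`, `h`, `h′` is the assembler's, after leaf N0b; nothing about them is asserted.) -/
theorem abs_tsum_dressed_le_of_local (μ ν : Fin 4) (h T h' : LatFun 4 ℝ) {ρ : ℕ} {B J₀ J₁ J₂ : ℝ} (hB : 0 ≤ B)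
    (hρ : ∀ x ∈ T.support, supNorm x ≤ ρ) (hT : ∀ x ∈ T.support, |T x| ≤ B)
    (h0 : ‖M0 h‖ ≤ J₀) (h0' : ‖M0 h'‖ ≤ J₀) (h1μ : ‖M1 μ h‖ ≤ J₁) (h1ν : ‖M1 ν h‖ ≤ J₁) (h1μ' : ‖M1 μ h'‖ ≤ J₁)
    (h1ν' : ‖M1 ν h'‖ ≤ J₁) (h2 : ‖M2 μ ν h‖ ≤ J₂) (h2' : ‖M2 μ ν h'‖ ≤ J₂) :
    |∑' x : Pt, (conv (conv h T) h') x * (x μ : ℝ) * (x ν : ℝ)| ≤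
      (2 * (ρ : ℝ) + 1) ^ 4 * B * (2 * (J₂ * J₀) + (ρ : ℝ) ^ 2 * J₀ ^ 2 + 4 * ((ρ : ℝ) * J₁ * J₀) + 2 * J₁ ^ 2) := by
  rw [tsum_eq_M2, ← Real.norm_eq_abs]
  exact norm_M2_dressed_le_of_local μ ν h T h' hB hρ (fun x hx => by rw [Real.norm_eq_abs]; exact hT x hx)
    h0 h0' h1μ h1ν h1μ' h1ν' h2 h2'

end RealValued

end

end Summit.QuantumFields.BalabanUV.Beta.FP.PerfectContact
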